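import Summits.NavierStokesRegularity.NavierStokesRegularity.Theorems.PerpetualPumpCircuitPumpTruncStructure
import Literature.Analysis.ODE.OneSidedComparison

/-!
# The precursor tower of a truncated Toda solution is slaved
# (crux `PerpetualPump.CircuitPump`, stmt-NavierStokesRegularity-1834;
# line `singular-clock-gspt`, sub-goal `toda_precursor_tower` of `stub_clockBox`)

For the `L`-truncated seeded graded Toda lattice (carrier `a n`, bond `b n`; modes `|n| > L` read
as `0` on `[0, T]`; `1 < lam ≤ 2`, `0 ≤ ε ≤ 1`) whose scale-`1` bond stays below `Zb` and whose
precursors (`n ≥ 2`) start in the box `|a n| ≤ α (2 lam)^{-n}`, `0 ≤ b n ≤ β (2 lam)^{-n}`, the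
tower is slaved over `[0, T]` (`toda_precursor_tower`): with `M = α + 4 lam³ Zb² T ≤ 2/5` every
precursor bond stays below `max (initial, 18 ε M² lam^{n/5} (2 lam)^{-2n})` and every precursor
carrier stays in the envelope `3 M (2 lam)^{-n}`, moving only by the bond fluxes.
Proof: a bootstrap (tree `maximalTimeP`) on the envelope `|a n| ≤ 3 M (2 lam)^{-n}`, `n ≥ 2`:
under it the bond rates are `≤ -lam^{4n/5}/2`, so `b n - max(…)` decays exponentially from a
non-positive value (tree `le_mul_exp_of_deriv_right_le`); the carriers obey `ȧ_n = -c_n a_n + f_n`,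
`c_n ≥ 0`, `|f_n| ≤ [n = 2] lam Zb² + 28 β² (2 lam)^{-n}`, whence `|a n t| ≤ |a n 0| + K_n t` by two
strict fences (Mathlib `image_le_of_deriv_right_lt_deriv_boundary'`) and a limit; this improves the
envelope to `2 M (2 lam)^{-n}` and closes the bootstrap over the finite family `2 ≤ n ≤ L`. [folklore]
-/
noncomputable section

-- the summit namespace `…NavierStokesRegularity.NavierStokesRegularity…` is the tree convention
set_option linter.dupNamespace false

namespace Summit.NavierStokesRegularity.NavierStokesRegularity.Theorems.PerpetualPumpCircuitPump

open Set Filter Topology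
open Literature.Analysis.ODE

/-- Power bookkeeping for the precursor scales: with `r = (2 lam)^{-x}`, `x ≥ 2`:
`lamˣ r ≤ 1/4`, `lam^{4x/5} ≥ 1`, `lam^{4x/5} lam^{x/5} = lamˣ`, `(2 lam)^{-2x} = r²`,
`lam^{x/5} r ≤ 1`, `(2 lam)^{-(x-1)} = 2 lam r`, `lam^{x-1} lam = lamˣ`, `(2 lam)^{-(x+1)} ≤ r/2`
(for `1 < lam`). [folklore] -/
theorem precursor_rpow_facts {lam x : ℝ} (h1 : 1 < lam) (hx : 2 ≤ x) :
    lam ^ x * (2 * lam) ^ (-x) ≤ 1 / 4 ∧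
    1 ≤ lam ^ ((4 / 5 : ℝ) * x) ∧
    lam ^ ((4 / 5 : ℝ) * x) * lam ^ (x / 5) = lam ^ x ∧
    (2 * lam) ^ (-(2 * x)) = (2 * lam) ^ (-x) * (2 * lam) ^ (-x) ∧
    lam ^ (x / 5) * (2 * lam) ^ (-x) ≤ 1 ∧
    (2 * lam) ^ (-(x - 1)) = 2 * lam * (2 * lam) ^ (-x) ∧
    lam ^ (x - 1) * lam = lam ^ x ∧
    (2 * lam) ^ (-(x + 1)) ≤ (2 * lam) ^ (-x) / 2 := by
  have hl : 0 < lam := by linarith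
  have h2l : 0 < 2 * lam := by linarith
  have hr : (2 * lam) ^ (-x) = 2 ^ (-x) * lam ^ (-x) := Real.mul_rpow (by norm_num) hl.le
  have hpl : lam ^ x * lam ^ (-x) = 1 := by
    rw [← Real.rpow_add hl, add_neg_cancel, Real.rpow_zero]
  have h2x : (2 : ℝ) ^ (-x) ≤ 1 / 4 :=
    calc (2 : ℝ) ^ (-x) ≤ 2 ^ (-(2 : ℝ)) :=
          Real.rpow_le_rpow_of_exponent_le (by norm_num) (by linarith)
      _ = 1 / 4 := by rw [Real.rpow_neg (by norm_num), Real.rpow_two]; norm_num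
  refine ⟨?_, Real.one_le_rpow h1.le (by linarith), ?_, ?_, ?_, ?_, ?_, ?_⟩
  · calc lam ^ x * (2 * lam) ^ (-x) = 2 ^ (-x) * (lam ^ x * lam ^ (-x)) := by rw [hr]; ring
      _ ≤ 1 / 4 := by rw [hpl, mul_one]; exact h2x
  · rw [← Real.rpow_add hl]; congr 1; ring
  · rw [← Real.rpow_add h2l]; congr 1; ring
  · have ha : (2 : ℝ) ^ (-x) ≤ 1 := Real.rpow_le_one_of_one_le_of_nonpos (by norm_num) (by linarith)
    have hb : lam ^ (x / 5) * lam ^ (-x) ≤ 1 := by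
      rw [← Real.rpow_add hl]
      exact Real.rpow_le_one_of_one_le_of_nonpos h1.le (by linarith)
    calc lam ^ (x / 5) * (2 * lam) ^ (-x) = 2 ^ (-x) * (lam ^ (x / 5) * lam ^ (-x)) := by
          rw [hr]; ring
      _ ≤ 1 * 1 := mul_le_mul ha hb (by positivity) zero_le_one
      _ = 1 := one_mul 1
  · rw [show -(x - 1) = -x + 1 by ring, Real.rpow_add h2l, Real.rpow_one]; ring
  · conv_rhs => rw [show x = (x - 1) + 1 by ring, Real.rpow_add hl, Real.rpow_one]
  · rw [show -(x + 1) = -x + (-1) by ring, Real.rpow_add h2l, Real.rpow_neg_one, div_eq_mul_inv]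
    exact mul_le_mul_of_nonneg_left (inv_anti₀ two_pos (by linarith)) (by positivity)

/-- Decay towards a floor: if `g' ≤ -κ g + κ fl` on `[0, τ)` with `κ ≥ 0` (`g` continuous on
`[0, τ]`, right derivative `g'`), then `g ≤ max (g 0) fl` on `[0, τ]`. [folklore] -/
theorem le_max_of_deriv_right_le {g g' : ℝ → ℝ} {τ κ fl : ℝ} (hg : ContinuousOn g (Icc 0 τ))
    (hg' : ∀ t ∈ Ico 0 τ, HasDerivWithinAt g (g' t) (Ici t) t) (hκ : 0 ≤ κ)
    (bound : ∀ t ∈ Ico 0 τ, g' t ≤ -κ * g t + κ * fl) :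
    ∀ t ∈ Icc 0 τ, g t ≤ max (g 0) fl := by
  intro t ht
  have hm : κ * fl ≤ κ * max (g 0) fl := mul_le_mul_of_nonneg_left (le_max_right _ _) hκ
  have h := le_mul_exp_of_deriv_right_le (f := fun s => g s - max (g 0) fl) (f' := g') (β := -κ)
    (hg.sub continuousOn_const) (fun s hs => (hg' s hs).sub_const _)
    (fun s hs => by have := bound s hs; linarith) t ht
  have h0 : g 0 - max (g 0) fl ≤ 0 := sub_nonpos.2 (le_max_left _ _)
  nlinarith [Real.exp_pos (-κ * (t - 0)), h0, h]

/-- Flux bound for a damped carrier: if `g' = -c g + f` on `[0, τ)` with `c ≥ 0` and `|f| ≤ K`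
(`g` continuous on `[0, τ]`, right derivative `g'`), then `|g t| ≤ |g 0| + K t` on `[0, τ]`
(two strict fences with margin `δ`, then `δ → 0`). [folklore] -/
theorem abs_le_abs_add_mul_of_deriv_right {g g' c f : ℝ → ℝ} {τ K : ℝ}
    (hg : ContinuousOn g (Icc 0 τ)) (hg' : ∀ t ∈ Ico 0 τ, HasDerivWithinAt g (g' t) (Ici t) t)
    (hform : ∀ t ∈ Ico 0 τ, g' t = -(c t * g t) + f t) (hc : ∀ t ∈ Ico 0 τ, 0 ≤ c t)
    (hf : ∀ t ∈ Ico 0 τ, |f t| ≤ K) : ∀ t ∈ Icc 0 τ, |g t| ≤ |g 0| + K * t := by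
  intro t ht
  -- strict fence with margin `δ` for `h ∈ {g, -g}`: its derivative is `≤ K` where `h ≥ 0`
  have key : ∀ δ : ℝ, 0 < δ → ∀ (h h' : ℝ → ℝ), ContinuousOn h (Icc 0 τ) →
      (∀ x ∈ Ico 0 τ, HasDerivWithinAt h (h' x) (Ici x) x) → h 0 ≤ |g 0| →
      (∀ x ∈ Ico 0 τ, 0 ≤ h x → h' x ≤ K) → h t ≤ |g 0| + δ + (K + δ) * t := by
    intro δ hδ h h' hh hh' h0 hb
    have hB : ∀ x ∈ Ico (0 : ℝ) τ,
        HasDerivWithinAt (fun y => |g 0| + δ + (K + δ) * y) (K + δ) (Ici x) x := by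
      intro x _
      simpa using (((hasDerivAt_id x).const_mul (K + δ)).const_add (|g 0| + δ)).hasDerivWithinAt
    have hBc : ContinuousOn (fun y => |g 0| + δ + (K + δ) * y) (Icc 0 τ) :=
      (continuous_const.add (continuous_const.mul continuous_id)).continuousOn
    refine image_le_of_deriv_right_lt_deriv_boundary' hh hh' (by simp only [mul_zero, add_zero]; linarith)
      hBc hB (fun x hx hx' => ?_) ht
    have hK0 : 0 ≤ K := (abs_nonneg _).trans (hf x hx)
    have hx0 : 0 ≤ h x := by rw [hx']; have := hx.1; positivity
    linarith [hb x hx hx0]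
  have hup : ∀ δ : ℝ, 0 < δ → g t ≤ |g 0| + δ + (K + δ) * t := fun δ hδ =>
    key δ hδ g g' hg hg' (le_abs_self _) fun x hx hx0 => by
      rw [hform x hx]; nlinarith [hc x hx, (abs_le.mp (hf x hx)).2]
  have hdn : ∀ δ : ℝ, 0 < δ → -g t ≤ |g 0| + δ + (K + δ) * t := fun δ hδ =>
    key δ hδ (fun x => -g x) (fun x => -g' x) hg.neg (fun x hx => (hg' x hx).neg) (neg_le_abs _)
      fun x hx hx0 => by
      rw [hform x hx]; nlinarith [hc x hx, (abs_le.mp (hf x hx)).1]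
  refine le_of_forall_pos_le_add fun e he => ?_
  have h1t : 0 < 1 + t := by linarith [ht.1]
  have hδ : 0 < e / (1 + t) := div_pos he h1t
  have h3 : e / (1 + t) + e / (1 + t) * t = e := by field_simp
  rw [abs_le]; constructor <;> nlinarith [hup _ hδ, hdn _ hδ]

/-- **Bond step.** Under the envelope at scales `n` and `n + 1` on `[0, τ)`, a precursor bond
`b n ≥ 0` (`n ≥ 2`) obeys `ḃ_n ≤ -(lam^{4n/5}/2) b_n + 9 ε M² lamⁿ (2 lam)^{-2n}`
(`lamⁿ (|a n| + |a (n+1)|) ≤ 9M/8 ≤ lam^{4n/5}/2`), hence stays below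
`max (b n 0, 18 ε M² lam^{n/5} (2 lam)^{-2n})`. [folklore] -/
theorem precursor_bond {lam ε M τ : ℝ} {n : ℤ} {a b : ℤ → ℝ → ℝ} (h1 : 1 < lam) (hε0 : 0 ≤ ε)
    (hM0 : 0 < M) (hM25 : M ≤ 2 / 5) (hn : 2 ≤ n) (hbc : ContinuousOn (b n) (Icc 0 τ))
    (hode : ∀ t ∈ Ico 0 τ, HasDerivWithinAt (b n)
      (-(lam ^ ((4 / 5 : ℝ) * n)) * b n t + lam ^ (n : ℝ) * b n t * (a n t - a (n + 1) t) +
        ε * lam ^ (n : ℝ) * a n t ^ 2) (Ici t) t)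
    (hpos : ∀ t ∈ Ico 0 τ, 0 ≤ b n t)
    (han : ∀ t ∈ Ico 0 τ, |a n t| ≤ 3 * M * (2 * lam) ^ (-(n : ℝ)))
    (han1 : ∀ t ∈ Ico 0 τ, |a (n + 1) t| ≤ 3 * M * (2 * lam) ^ (-((n : ℝ) + 1))) :
    ∀ t ∈ Icc 0 τ,
      b n t ≤ max (b n 0) (18 * ε * M ^ 2 * lam ^ ((n : ℝ) / 5) * (2 * lam) ^ (-(2 * (n : ℝ)))) := by
  obtain ⟨F3, F2, F4, F5, -, -, -, F9⟩ :=
    precursor_rpow_facts (x := (n : ℝ)) h1 (by exact_mod_cast hn)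
  have hr0 : 0 < (2 * lam) ^ (-(n : ℝ)) := by positivity
  have hd0 : 0 < lam ^ ((4 / 5 : ℝ) * (n : ℝ)) := by positivity
  have hp0 : 0 < lam ^ (n : ℝ) := by positivity
  rw [F5]
  set r := (2 * lam) ^ (-(n : ℝ))
  set d := lam ^ ((4 / 5 : ℝ) * (n : ℝ))
  set p := lam ^ (n : ℝ)
  set q := lam ^ ((n : ℝ) / 5)
  refine le_max_of_deriv_right_le (κ := d / 2) hbc hode (by positivity) fun s hs => ?_
  have hbs := hpos s hs
  have hA : a n s ≤ 3 * M * r := (abs_le.mp (han s hs)).2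
  have hA1 : -a (n + 1) s ≤ 3 * M * (r / 2) := by
    have := (abs_le.mp (han1 s hs)).1
    have := mul_le_mul_of_nonneg_left F9 (by positivity : (0 : ℝ) ≤ 3 * M)
    linarith
  -- the rate `p (a n - a (n+1)) ≤ 9M/8 ≤ d/2` and the seed `ε p a² ≤ 9 ε M² p r²`
  have e1 : p * (a n s - a (n + 1) s) ≤ d / 2 := by
    have := mul_le_mul_of_nonneg_left (by linarith : a n s - a (n + 1) s ≤ 9 / 2 * M * r) hp0.le
    have := mul_le_mul_of_nonneg_left F3 (by positivity : (0 : ℝ) ≤ 9 / 2 * M)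
    linarith
  have e2 : ε * p * a n s ^ 2 ≤ ε * p * (3 * M * r) ^ 2 := by
    apply mul_le_mul_of_nonneg_left _ (by positivity)
    rw [← sq_abs (a n s)]
    exact pow_le_pow_left₀ (abs_nonneg _) (han s hs) 2
  calc -d * b n s + p * b n s * (a n s - a (n + 1) s) + ε * p * a n s ^ 2
      = -d * b n s + p * (a n s - a (n + 1) s) * b n s + ε * p * a n s ^ 2 := by ring
    _ ≤ -d * b n s + d / 2 * b n s + ε * p * (3 * M * r) ^ 2 := by
        linarith [mul_le_mul_of_nonneg_right e1 hbs, e2]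
    _ = -(d / 2) * b n s + d / 2 * (18 * ε * M ^ 2 * q * (r * r)) := by rw [← F4]; ring

/-- **Carrier step.** At a precursor scale `n ≥ 2` the carrier obeys `ȧ_n = -c_n a_n + f_n` with
`c_n = lam^{4n/5} + ε lamⁿ b_n ≥ 0` and flux `f_n = lam^{n-1} b_{n-1}² - lamⁿ b_n²`; with the
precursor bonds below `β (2 lam)^{-·}` and `0 ≤ b 1 ≤ Zb`, `|f_n| ≤ [n = 2] lam Zb² + 28 β² (2 lam)^{-n}`,
so `|a n t| ≤ |a n 0| + K_n t`, which is `≤ 2 M (2 lam)^{-n}` by the choice of `M`. [folklore] -/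
theorem precursor_carrier {lam ε T α β Zb M τ t : ℝ} {n : ℤ} {a b : ℤ → ℝ → ℝ}
    (h1 : 1 < lam) (h2 : lam ≤ 2) (hε0 : 0 ≤ ε) (hM : M = α + 4 * lam ^ 3 * Zb ^ 2 * T)
    (hαM : α ≤ M) (hβT : 28 * β ^ 2 * T ≤ M) (hn : 2 ≤ n) (hτT : τ ≤ T) (ht : t ∈ Icc 0 τ)
    (hac : ContinuousOn (a n) (Icc 0 τ))
    (hode : ∀ s ∈ Ico 0 τ, HasDerivWithinAt (a n)
      (-(lam ^ ((4 / 5 : ℝ) * n)) * a n s - lam ^ (n : ℝ) * b n s ^ 2 +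
        lam ^ ((n : ℝ) - 1) * b (n - 1) s ^ 2 - ε * lam ^ (n : ℝ) * a n s * b n s) (Ici s) s)
    (hpos : ∀ m : ℤ, ∀ s ∈ Ico 0 τ, 0 ≤ b m s)
    (hbn : ∀ s ∈ Ico 0 τ, b n s ≤ β * (2 * lam) ^ (-(n : ℝ)))
    (hbm : 3 ≤ n → ∀ s ∈ Ico 0 τ, b (n - 1) s ≤ β * (2 * lam) ^ (-((n : ℝ) - 1)))
    (hb1 : ∀ s ∈ Ico 0 τ, b 1 s ≤ Zb) (ha0 : |a n 0| ≤ α * (2 * lam) ^ (-(n : ℝ))) :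
    |a n t| ≤ |a n 0| + (if n = 2 then lam * Zb ^ 2 * t else 0) +
        28 * β ^ 2 * (2 * lam) ^ (-(n : ℝ)) * t ∧
      |a n t| ≤ 2 * M * (2 * lam) ^ (-(n : ℝ)) := by
  obtain ⟨F3, -, -, -, -, F7, F8, -⟩ :=
    precursor_rpow_facts (x := (n : ℝ)) h1 (by exact_mod_cast hn)
  have hl : 0 < lam := by linarith
  have ht0 : 0 ≤ t := ht.1
  have hr0 : 0 < (2 * lam) ^ (-(n : ℝ)) := by positivity
  have hd0 : 0 < lam ^ ((4 / 5 : ℝ) * (n : ℝ)) := by positivity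
  have hp0 : 0 < lam ^ (n : ℝ) := by positivity
  set r := (2 * lam) ^ (-(n : ℝ)) with hr
  set d := lam ^ ((4 / 5 : ℝ) * (n : ℝ))
  set p := lam ^ (n : ℝ)
  -- the flux constant `K` and the closing inequality `α r + K T ≤ 2 M r`
  set K := (if n = 2 then lam * Zb ^ 2 else 0) + 28 * β ^ 2 * r with hK
  have hite : 0 ≤ (if n = 2 then lam * Zb ^ 2 else 0) := by split_ifs <;> positivity
  have hK0 : 0 ≤ K := by positivity
  have hKt : K * t = (if n = 2 then lam * Zb ^ 2 * t else 0) + 28 * β ^ 2 * r * t := by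
    simp only [hK]; split_ifs <;> ring
  have h3 : 28 * β ^ 2 * T * r ≤ M * r := mul_le_mul_of_nonneg_right hβT hr0.le
  have hclose : α * r + K * T ≤ 2 * M * r := by
    simp only [hK]
    split_ifs with hn2
    · have e1 : (n : ℝ) = 2 := by exact_mod_cast hn2
      have hr2 : r = 1 / (4 * lam ^ 2) := by
        rw [hr, e1, Real.rpow_neg (by positivity), Real.rpow_two]; ring
      have h4 : lam * Zb ^ 2 * T = 4 * lam ^ 3 * Zb ^ 2 * T * r := by
        rw [hr2]; field_simp
      have h5 : M * r = (α + 4 * lam ^ 3 * Zb ^ 2 * T) * r := by rw [hM]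
      linarith
    · have := mul_le_mul_of_nonneg_right hαM hr0.le
      linarith
  -- the flux bound `|f_n| ≤ K`
  have hF : ∀ s ∈ Ico 0 τ, |lam ^ ((n : ℝ) - 1) * b (n - 1) s ^ 2 - p * b n s ^ 2| ≤ K := by
    intro s hs
    have hy0 : 0 ≤ p * b n s ^ 2 := by positivity
    have hy : p * b n s ^ 2 ≤ β ^ 2 * r / 4 := by
      have hsq : b n s ^ 2 ≤ (β * r) ^ 2 := pow_le_pow_left₀ (hpos n s hs) (hbn s hs) 2
      have := mul_le_mul_of_nonneg_left hsq hp0.le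
      have := mul_le_mul_of_nonneg_left F3 (by positivity : (0 : ℝ) ≤ β ^ 2 * r)
      linarith
    have hx0 : 0 ≤ lam ^ ((n : ℝ) - 1) * b (n - 1) s ^ 2 := by positivity
    have hx : lam ^ ((n : ℝ) - 1) * b (n - 1) s ^ 2 ≤
        (if n = 2 then lam * Zb ^ 2 else 0) + 2 * β ^ 2 * r := by
      have hβr : 0 ≤ β ^ 2 * r := by positivity
      split_ifs with hn2
      · have e1 : (n : ℝ) = 2 := by exact_mod_cast hn2
        have e2 : n - 1 = 1 := by omega
        have e3 : lam ^ ((n : ℝ) - 1) = lam := by rw [e1]; norm_num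
        rw [e2, e3]
        have hsq : b 1 s ^ 2 ≤ Zb ^ 2 := pow_le_pow_left₀ (hpos 1 s hs) (hb1 s hs) 2
        have := mul_le_mul_of_nonneg_left hsq hl.le
        linarith
      · have hb2' := hbm (by omega) s hs
        rw [F7] at hb2'
        have hsq : b (n - 1) s ^ 2 ≤ (2 * lam * r * β) ^ 2 :=
          pow_le_pow_left₀ (hpos (n - 1) s hs) (by linarith) 2
        have h5 : lam * (p * r) ≤ 2 * (1 / 4) := mul_le_mul h2 F3 (by positivity) (by norm_num)
        calc lam ^ ((n : ℝ) - 1) * b (n - 1) s ^ 2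
            ≤ lam ^ ((n : ℝ) - 1) * (2 * lam * r * β) ^ 2 :=
              mul_le_mul_of_nonneg_left hsq (by positivity)
          _ = lam * (p * r) * (4 * β ^ 2 * r) := by rw [← F8]; ring
          _ ≤ 2 * (1 / 4) * (4 * β ^ 2 * r) := mul_le_mul_of_nonneg_right h5 (by positivity)
          _ = 0 + 2 * β ^ 2 * r := by ring
    have hβr : 0 ≤ β ^ 2 * r := by positivity
    rw [abs_le]
    constructor <;> linarith
  have hflux := abs_le_abs_add_mul_of_deriv_right (τ := τ) (K := K) (g := a n)
    (c := fun s => d + ε * p * b n s)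
    (f := fun s => lam ^ ((n : ℝ) - 1) * b (n - 1) s ^ 2 - p * b n s ^ 2) hac hode
    (fun s _ => show _ = -((d + ε * p * b n s) * a n s) +
        (lam ^ ((n : ℝ) - 1) * b (n - 1) s ^ 2 - p * b n s ^ 2) by ring)
    (fun s hs => show 0 ≤ d + ε * p * b n s by have := hpos n s hs; positivity) hF t ht
  refine ⟨hflux.trans_eq (by rw [hKt]; ring), hflux.trans ?_⟩
  have : K * t ≤ K * T := mul_le_mul_of_nonneg_left (ht.2.trans hτT) hK0
  linarith

/-- **PRECURSOR TOWER.** For an `L`-truncated seeded Toda solution on `[0,T]` (`1 < lam ≤ 2`, `0 ≤ ε ≤ 1`)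
whose new bond at scale `1` stays below `Zb` and whose precursors (scales `n ≥ 2`) start in the super-geometric
box `|a n| ≤ α (2lam)^{−n}`, `0 ≤ b n ≤ β (2lam)^{−n}`: with the envelope `M = α + 4 lam³ Zb² T ≤ 2/5` the
precursor bonds all have NEGATIVE growth rates (`lamⁿ(|a n| + |a (n+1)|) ≤ lam^{4n/5}/2`), hence stay below
`max(initial, seed floor)`, and the carriers move only by the bond fluxes (plus, at `n = 2`, the feed `lam Zb²`
from the scale-1 bond). [folklore] -/
theorem toda_precursor_tower :
    ∀ (lam ε T α β Zb M : ℝ) (L : ℕ) (a b : ℤ → ℝ → ℝ),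
    1 < lam → lam ≤ 2 → 0 ≤ ε → ε ≤ 1 → 0 < T → T ≤ 1 / 2 → 0 ≤ α → 0 ≤ β → β ≤ 1 → 0 ≤ Zb →
    M = α + 4 * lam ^ 3 * Zb ^ 2 * T → 0 < M → M ≤ 2 / 5 → 18 * ε * M ^ 2 ≤ β → 28 * β ^ 2 * T ≤ M →
    (∀ n : ℤ, (L : ℤ) < |n| → ∀ t ∈ Set.Icc 0 T, a n t = 0 ∧ b n t = 0) →
    (∀ n : ℤ, |n| ≤ (L : ℤ) → ContinuousOn (a n) (Set.Icc 0 T) ∧ ContinuousOn (b n) (Set.Icc 0 T)) →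
    (∀ n : ℤ, |n| ≤ (L : ℤ) → ∀ t ∈ Set.Ico 0 T,
      HasDerivWithinAt (a n)
        (-(lam ^ ((4 / 5 : ℝ) * n)) * a n t - lam ^ (n : ℝ) * b n t ^ 2 +
          lam ^ ((n : ℝ) - 1) * b (n - 1) t ^ 2 - ε * lam ^ (n : ℝ) * a n t * b n t) (Set.Ici t) t ∧
      HasDerivWithinAt (b n)
        (-(lam ^ ((4 / 5 : ℝ) * n)) * b n t + lam ^ (n : ℝ) * b n t * (a n t - a (n + 1) t) +
          ε * lam ^ (n : ℝ) * a n t ^ 2) (Set.Ici t) t) →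
    (∀ n : ℤ, 0 ≤ b n 0) →
    (∀ t ∈ Set.Icc 0 T, b 1 t ≤ Zb) →
    (∀ n : ℤ, 2 ≤ n → |a n 0| ≤ α * (2 * lam) ^ (-(n : ℝ)) ∧ b n 0 ≤ β * (2 * lam) ^ (-(n : ℝ))) →
    ∀ t ∈ Set.Icc 0 T, ∀ n : ℤ, 2 ≤ n →
      0 ≤ b n t ∧
      b n t ≤ max (b n 0) (18 * ε * M ^ 2 * lam ^ ((n : ℝ) / 5) * (2 * lam) ^ (-(2 * (n : ℝ)))) ∧
      |a n t| ≤ 3 * M * (2 * lam) ^ (-(n : ℝ)) ∧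
      |a n t| ≤ |a n 0| + (if n = 2 then lam * Zb ^ 2 * t else 0) + 28 * β ^ 2 * (2 * lam) ^ (-(n : ℝ)) * t := by
  intro lam ε T α β Zb M L a b h1 h2 hε0 _hε1 hT _hT2 hα hβ _hβ1 hZb hM hM0 hM25 hεM hβT
    hzero hcont hode hb0 hZ hinit
  have hl : 0 < lam := by linarith
  -- bond positivity (sibling `toda_trunc_structure`) and continuity of every mode
  have hpos : ∀ n : ℤ, ∀ t ∈ Icc 0 T, 0 ≤ b n t :=
    (toda_trunc_structure lam ε T L a b hl hε0 hT hzero hcont hode hb0).1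
  have hall : ∀ n : ℤ, ContinuousOn (a n) (Icc 0 T) ∧ ContinuousOn (b n) (Icc 0 T) := by
    intro n
    rcases le_or_gt |n| (L : ℤ) with hn | hn
    · exact hcont n hn
    · exact ⟨(continuousOn_const (c := (0 : ℝ))).congr fun s hs => (hzero n hn s hs).1,
        (continuousOn_const (c := (0 : ℝ))).congr fun s hs => (hzero n hn s hs).2⟩
  have hαM : α ≤ M := by rw [hM]; exact le_add_of_nonneg_right (by positivity)
  -- CORE: consequences of the envelope `|a n| ≤ 3 M (2 lam)^{-n}` on an initial segment `[0, τ]`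
  have core : ∀ τ ∈ Icc 0 T,
      (∀ t ∈ Icc 0 τ, ∀ n : ℤ, 2 ≤ n → |a n t| ≤ 3 * M * (2 * lam) ^ (-(n : ℝ))) →
      ∀ t ∈ Icc 0 τ, ∀ n : ℤ, 2 ≤ n →
      b n t ≤ max (b n 0) (18 * ε * M ^ 2 * lam ^ ((n : ℝ) / 5) * (2 * lam) ^ (-(2 * (n : ℝ)))) ∧
      |a n t| ≤ |a n 0| + (if n = 2 then lam * Zb ^ 2 * t else 0) +
        28 * β ^ 2 * (2 * lam) ^ (-(n : ℝ)) * t ∧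
      |a n t| ≤ 2 * M * (2 * lam) ^ (-(n : ℝ)) := by
    intro τ hτ hPτ
    have hτT : Icc 0 τ ⊆ Icc 0 T := Icc_subset_Icc le_rfl hτ.2
    have hτT' : Ico 0 τ ⊆ Ico 0 T := Ico_subset_Ico le_rfl hτ.2
    have hIT : Ico 0 τ ⊆ Icc 0 T := Ico_subset_Icc_self.trans hτT
    -- (1) bonds sit below `max (initial, seed floor)`
    have hbond : ∀ n : ℤ, 2 ≤ n → ∀ t ∈ Icc 0 τ, b n t ≤
        max (b n 0) (18 * ε * M ^ 2 * lam ^ ((n : ℝ) / 5) * (2 * lam) ^ (-(2 * (n : ℝ)))) := by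
      intro n hn t ht
      have habs : |n| = n := abs_of_nonneg (by omega)
      rcases le_or_gt n (L : ℤ) with hnL | hnL
      · have hnL' : |n| ≤ (L : ℤ) := by rw [habs]; exact hnL
        refine precursor_bond h1 hε0 hM0 hM25 hn ((hall n).2.mono hτT)
          (fun s hs => (hode n hnL' s (hτT' hs)).2) (fun s hs => hpos n s (hIT hs))
          (fun s hs => hPτ s (Ico_subset_Icc_self hs) n hn) (fun s hs => ?_) t ht
        exact_mod_cast hPτ s (Ico_subset_Icc_self hs) (n + 1) (by omega)
      · have hnL' : (L : ℤ) < |n| := by rw [habs]; exact hnL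
        rw [(hzero n hnL' t (hτT ht)).2]
        exact le_max_of_le_left (hzero n hnL' 0 ⟨le_rfl, hT.le⟩).2.ge
    -- hence every precursor bond is below `β (2 lam)^{-n}` on `[0, τ]`
    have hbβ : ∀ i : ℤ, 2 ≤ i → ∀ s ∈ Icc 0 τ, b i s ≤ β * (2 * lam) ^ (-(i : ℝ)) := by
      intro i hi s hs
      obtain ⟨-, -, -, F5, F6, -⟩ := precursor_rpow_facts (x := (i : ℝ)) h1 (by exact_mod_cast hi)
      have h := hbond i hi s hs
      rw [F5] at h
      have hr0 : 0 < (2 * lam) ^ (-(i : ℝ)) := by positivity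
      refine h.trans (max_le (hinit i hi).2 ?_)
      have hm : 18 * ε * M ^ 2 * (lam ^ ((i : ℝ) / 5) * (2 * lam) ^ (-(i : ℝ))) ≤ β * 1 :=
        mul_le_mul hεM F6 (by positivity) hβ
      calc 18 * ε * M ^ 2 * lam ^ ((i : ℝ) / 5) * ((2 * lam) ^ (-(i : ℝ)) * (2 * lam) ^ (-(i : ℝ)))
          = 18 * ε * M ^ 2 * (lam ^ ((i : ℝ) / 5) * (2 * lam) ^ (-(i : ℝ))) *
              (2 * lam) ^ (-(i : ℝ)) := by ring
        _ ≤ β * 1 * (2 * lam) ^ (-(i : ℝ)) := mul_le_mul_of_nonneg_right hm hr0.le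
        _ = β * (2 * lam) ^ (-(i : ℝ)) := by ring
    -- (2)+(3) carriers
    intro t ht n hn
    refine ⟨hbond n hn t ht, ?_⟩
    have habs : |n| = n := abs_of_nonneg (by omega)
    rcases le_or_gt n (L : ℤ) with hnL | hnL
    · have hnL' : |n| ≤ (L : ℤ) := by rw [habs]; exact hnL
      refine precursor_carrier h1 h2 hε0 hM hαM hβT hn hτ.2 ht ((hall n).1.mono hτT)
        (fun s hs => (hode n hnL' s (hτT' hs)).1) (fun m s hs => hpos m s (hIT hs))
        (fun s hs => hbβ n hn s (Ico_subset_Icc_self hs)) (fun hn3 s hs => ?_)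
        (fun s hs => hZ s (hIT hs)) (hinit n hn).1
      exact_mod_cast hbβ (n - 1) (by omega) s (Ico_subset_Icc_self hs)
    · have hnL' : (L : ℤ) < |n| := by rw [habs]; exact hnL
      have ht0 : 0 ≤ t := ht.1
      have hite : 0 ≤ (if n = 2 then lam * Zb ^ 2 * t else 0) := by split_ifs <;> positivity
      rw [(hzero n hnL' t (hτT ht)).1, abs_zero]
      exact ⟨by positivity, by positivity⟩
  -- BOOTSTRAP: the envelope holds at `0`, is closed and improves itself strictly: max time `T`
  obtain ⟨P, hP⟩ : ∃ P : ℝ → Prop, ∀ t, P t ↔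
      ∀ n : ℤ, 2 ≤ n → |a n t| ≤ 3 * M * (2 * lam) ^ (-(n : ℝ)) := ⟨_, fun t => Iff.rfl⟩
  have hP0 : P 0 := (hP 0).2 fun n hn => by
    have hr : 0 < (2 * lam) ^ (-(n : ℝ)) := by positivity
    have h1' := mul_le_mul_of_nonneg_right hαM hr.le
    have h2' : 0 ≤ M * (2 * lam) ^ (-(n : ℝ)) := by positivity
    linarith [(hinit n hn).1]
  have hclosed : ∀ t ∈ Ioc 0 T, (∀ s ∈ Ico 0 t, P s) → P t := fun t ht h =>
    (hP t).2 fun n hn => le_const_of_forall_Ico (g := fun s => |a n s|) (hall n).1.abs ht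
      fun s hs => (hP s).1 (h s hs) n hn
  have ht₁mem : maximalTimeP P 0 T ∈ Icc 0 T := maximalTimeP_mem (P := P) hT.le hP0
  have hPt₁ : ∀ t ∈ Icc 0 (maximalTimeP P 0 T), ∀ n : ℤ, 2 ≤ n →
      |a n t| ≤ 3 * M * (2 * lam) ^ (-(n : ℝ)) := fun t ht =>
    (hP t).1 (maximalTimeP_spec (P := P) hT.le hP0 hclosed ht)
  have ht₁T : maximalTimeP P 0 T = T := by
    by_contra hne
    have hlt : maximalTimeP P 0 T < T := lt_of_le_of_ne ht₁mem.2 hne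
    refine not_eventually_of_maximalTimeP_lt (P := P) hT.le hP0 hlt ?_
    have hfin : ∀ n ∈ Finset.Icc (2 : ℤ) (L : ℤ), ∀ᶠ t in 𝓝[Icc 0 T] maximalTimeP P 0 T,
        |a n t| ≤ 3 * M * (2 * lam) ^ (-(n : ℝ)) := by
      intro n hn
      have hn2 : 2 ≤ n := (Finset.mem_Icc.mp hn).1
      have h2M := (core _ ht₁mem hPt₁ _ ⟨ht₁mem.1, le_rfl⟩ n hn2).2.2
      have hlt3 : |a n (maximalTimeP P 0 T)| < 3 * M * (2 * lam) ^ (-(n : ℝ)) := by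
        have : 0 < M * (2 * lam) ^ (-(n : ℝ)) := by positivity
        linarith
      exact (((hall n).1.abs _ ht₁mem).eventually_lt_const hlt3).mono fun _ h => h.le
    filter_upwards [(eventually_all_finset _).mpr hfin, self_mem_nhdsWithin] with t ht htT
    refine (hP t).2 fun n hn => ?_
    rcases le_or_gt n (L : ℤ) with hnL | hnL
    · exact ht n (Finset.mem_Icc.mpr ⟨hn, hnL⟩)
    · have hnL' : (L : ℤ) < |n| := by rw [abs_of_nonneg (by omega)]; exact hnL
      rw [(hzero n hnL' t htT).1, abs_zero]; positivity
  -- conclusion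
  intro t ht n hn
  have hPT : ∀ s ∈ Icc 0 T, ∀ n : ℤ, 2 ≤ n → |a n s| ≤ 3 * M * (2 * lam) ^ (-(n : ℝ)) :=
    fun s hs => hPt₁ s (by rw [ht₁T]; exact hs)
  obtain ⟨c2, c4, -⟩ := core T ⟨hT.le, le_rfl⟩ hPT t ht n hn
  exact ⟨hpos n t ht, c2, hPT t ht n hn, c4⟩

end Summit.NavierStokesRegularity.NavierStokesRegularity.Theorems.PerpetualPumpCircuitPump
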